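import Summits.RiemannHypothesis.RiemannHypothesis.Theorems.TiltedLandingLaw421R3BurgersRate

/-!
# TWO-PAIR DATUM W1* (lens-2 g5, director (CA614)/(CA615) L5) — crit-1's witness frame TYPED: `Touches ∧ AtomicPair ∧ floor` at a CONSUMPTION level

crit-1 g4 (CUT 21, memo `crit-g4/cut21/CUT21-T-verdict.md` 6b4e9cc6ff59964b) killed (T) v1 AS TYPED with the legal rational two-pair frame
`f(w) = e^{40w}·(w² + 1)·((w − 369/10000)² + (10065/10000)²)`, `(η, x₀, s, hmax, R, Hs, B) = (1/2, 0, 1/100, 1, 31/10, 10065/10000, 309)`, level `j = 0`,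
`v = i`, toucher `z = 369/10000 + (10065/10000)i` — a CONSUMPTION level (the mate sits in the tent), where `X = (E − childEnergy)·κ_v² = 0.5143 < 1`.
This file is the KERNEL HOME of that frame's pair geometry and state field (tree imports only; 0 sorry):

* `fS`, `fS_eq_zero_iff` (zero set `{i, −i, z, z̄}`, `e^{40w} ≠ 0`), `fS_real`, `differentiable_fS`, `zeros_im_le_Hs`, `seed_S` — the CHEAP fields of
  `EngineHyps5 2 (1/2) fS 0 (1/100) 1 (31/10) (10065/10000) 309` (differentiable, real, zero heights ≤ Hs, the seed zero `i` on the axis `x₀ = 0`, and the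
  numeric inequalities `numerics_S`).  NOT discharged here (said plainly): the growth field, `ColumnBudgetMult`, `HalfSlabBudget`, `RemainderBox` (crit-1: remainder
  sup ≤ 41.3 ≤ η/s = 50 on paper) — an `engineHyps5_S` theorem is therefore NOT claimed; nor `Charged`/`ConsLevelQ` (tracking machinery).
* `touches_S`, `atomicPair_S` — (T)'s binders `Touches fS 0 i z`, `AtomicPair fS 0 i z` written out (defeq to the crux workfile's, cf. the bridge probe of
  `TwoPairDatum-v1`); `covered_S` — `v = i` is COVERED by `z` (`Im z² > Im v² + (Re v − Re z)²`: the mate sits inside the tent).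
* `dslope_fS_I` (the divided difference at the simple zero `i` is the cofactor `QS = e^{40w}(w + i)((w − a)² + b²)`), `newtonK_S`, ★ `tiltAt_S` — the state
  field in CLOSED FORM `tiltAt fS 0 i = (40·D + 2(i − a))/D`, `D := (i − a)² + b²` (= `40 + 1/(i − z) + 1/(i − z̄)`, crit-1's `κ_v` expression), and
  ★ `floor_S : 14 ≤ Im v·‖tiltAt fS 0 v‖` (`‖tilt‖² = 1.158664/0.00565391 = 204.93`, `κ_v = 14.3155`): the FLOOR binder holds with λ ≥ 14 ≫ 3, so no floor
  rescues v1 — exactly crit-1's point; what rescues the law is the APPROACH binder of v2 (`lens2/TouchedDissipation-v2.lean`).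

Nothing here bears on the truth of RH; RH is not proved; (T) v1 refuted as typed, C′ typed not proved; ★A / 33346 / 33347 OPEN; a typed frame is not a law.
-/

open Complex

namespace RhW08.TwoPairDatumW

/-- crit-1's W1* function `f(w) = e^{40w}(w²+1)((w − 369/10000)² + (10065/10000)²)`. -/
noncomputable def fS (w : ℂ) : ℂ :=
  Complex.exp (40 * w) * ((w ^ 2 + 1) * ((w - 369 / 10000) ^ 2 + (10065 / 10000) ^ 2))

/-- The toucher `z = 369/10000 + (10065/10000)i` (height `Hs`, strictly taller than `v = i`, laterally `0.0369` off). -/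
noncomputable def zS : ℂ := 369 / 10000 + 10065 / 10000 * I

/-- `D := (i − a)² + b²`, the toucher pair's quadratic evaluated at `v = i`. -/
noncomputable def DW : ℂ := (I - 369 / 10000) ^ 2 + (10065 / 10000 : ℂ) ^ 2

/-- The cofactor of the simple zero `i`: `QS(w) = e^{40w}(w + i)((w − a)² + b²)`. -/
noncomputable def QS (w : ℂ) : ℂ :=
  Complex.exp (40 * w) * ((w + I) * ((w - 369 / 10000) ^ 2 + (10065 / 10000) ^ 2))

/-- The derivative of the cofactor (product rule, unexpanded). -/
noncomputable def QS' (w : ℂ) : ℂ :=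
  Complex.exp (40 * w) * 40 * ((w + I) * ((w - 369 / 10000) ^ 2 + (10065 / 10000) ^ 2)) +
    Complex.exp (40 * w) * (1 * ((w - 369 / 10000) ^ 2 + (10065 / 10000) ^ 2) + (w + I) * (2 * (w - 369 / 10000)))

/-! ## §1 Zero set and the cheap frame fields -/

/-- The toucher pair's quadratic factors over `ℂ`: `(w − a)² + b² = (w − z)(w − z̄)`. -/
theorem quad_factor (w : ℂ) :
    (w - 369 / 10000) ^ 2 + (10065 / 10000 : ℂ) ^ 2 = (w - zS) * (w - (369 / 10000 - 10065 / 10000 * I)) := by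
  unfold zS
  linear_combination ((10065 / 10000 : ℂ) ^ 2) * I_sq

/-- The zero set of `fS`: `{i, −i, z, z̄}` (the exponential never vanishes). -/
theorem fS_eq_zero_iff (u : ℂ) : fS u = 0 ↔ u = I ∨ u = -I ∨ u = zS ∨ u = 369 / 10000 - 10065 / 10000 * I := by
  have h1 : u ^ 2 + 1 = (u - I) * (u + I) := by linear_combination (1 : ℂ) * I_sq
  rw [fS, quad_factor, h1]
  simp only [mul_eq_zero, Complex.exp_ne_zero, false_or, sub_eq_zero, add_eq_zero_iff_eq_neg]
  tauto

/-- `fS` is real on the real axis. -/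
theorem fS_real (x : ℝ) : (fS x).im = 0 := by
  have h : fS x = ((Real.exp (40 * x) * ((x ^ 2 + 1) * ((x - 369 / 10000) ^ 2 + (10065 / 10000) ^ 2)) : ℝ) : ℂ) := by
    unfold fS; push_cast; ring_nf
  rw [h, ofReal_im]

/-- `fS` is entire. -/
theorem differentiable_fS : Differentiable ℂ fS := by
  unfold fS; fun_prop

/-- Every zero of `fS` has `|Im| ≤ Hs = 10065/10000`. -/
theorem zeros_im_le_Hs (w : ℂ) (hw : fS w = 0) : |w.im| ≤ 10065 / 10000 := by
  rcases (fS_eq_zero_iff w).1 hw with rfl | rfl | rfl | rfl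
  · norm_num
  · norm_num
  · rw [show zS.im = 10065 / 10000 by simp [zS]]; norm_num
  · norm_num

/-- The seed zero on the axis `x₀ = 0` below `hmax = 1`: `w₀ = i`. -/
theorem seed_S : ∃ w₀ : ℂ, fS w₀ = 0 ∧ w₀.im ≠ 0 ∧ w₀.re = 0 ∧ |w₀.im| ≤ 1 :=
  ⟨I, (fS_eq_zero_iff I).2 (Or.inl rfl), by simp, by simp, by simp⟩

/-- The numeric inequalities of `EngineHyps5 2` for `(η, s, hmax, R, Hs) = (1/2, 1/100, 1, 31/10, 10065/10000)`:
`0 < s`, `2s ≤ hmax`, `2·hmax ≤ R`, `3·hmax < R`, `0 ≤ Hs`, `2·Hs ≤ R`, `0 ≤ η`, `2η ≤ 1`. -/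
theorem numerics_S : (0 : ℝ) < 1 / 100 ∧ (2 : ℝ) * (1 / 100) ≤ 1 ∧ (2 : ℝ) * 1 ≤ 31 / 10 ∧ (3 : ℝ) * 1 < 31 / 10 ∧
    (0 : ℝ) ≤ 10065 / 10000 ∧ (2 : ℝ) * (10065 / 10000) ≤ 31 / 10 ∧ (0 : ℝ) ≤ 1 / 2 ∧ (2 : ℝ) * (1 / 2) ≤ 1 := by
  norm_num

/-! ## §2 (T)'s pair binders at `(fS, 0, i, z)` -/

/-- `Touches fS 0 i z` written out: `z` is a zero of `fS^{(0)}`, strictly taller (`1 < 1.0065`), discs meet (`|0 − 0.0369| ≤ 1 + 1.0065`). -/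
theorem touches_S : iteratedDeriv 0 fS zS = 0 ∧ I.im < zS.im ∧ |I.re - zS.re| ≤ I.im + zS.im := by
  refine ⟨?_, ?_, ?_⟩
  · rw [iteratedDeriv_zero]; exact (fS_eq_zero_iff _).2 (Or.inr (Or.inr (Or.inl rfl)))
  · simp [zS]; norm_num
  · simp [zS]; norm_num [abs_of_nonneg]

/-- `AtomicPair fS 0 i z` written out: there is no third upper zero. -/
theorem atomicPair_S : ∀ u : ℂ, iteratedDeriv 0 fS u = 0 → 0 < u.im → u ≠ I → u ≠ zS →
    I.im + u.im < |I.re - u.re| ∧ zS.im + u.im < |zS.re - u.re| := by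
  intro u hu him hI hz
  rw [iteratedDeriv_zero, fS_eq_zero_iff] at hu
  rcases hu with rfl | rfl | rfl | rfl
  · exact absurd rfl hI
  · exact absurd him (by norm_num)
  · exact absurd rfl hz
  · exact absurd him (by norm_num)

/-- `v = i` is COVERED by the toucher `z`: the closed Jensen disc of `z` contains the point `v` strictly, i.e. `¬ (Im z² ≤ Im v² + (Re v − Re z)²)`
(`1.0065² = 1.01304 > 1 + 0.0369² = 1.00136`) — the W1* level is a COVERED, consumption-level toucher configuration (the mate sits inside the tent). -/
theorem covered_S : ¬ (zS.im ^ 2 ≤ I.im ^ 2 + (I.re - zS.re) ^ 2) := by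
  simp [zS]; norm_num

/-! ## §3 The state field in closed form and the floor -/

/-- `fS = (· − i) • QS` as functions. -/
theorem fS_eq_sub_smul_QS : fS = fun w => (w - I) • QS w := by
  funext w
  rw [smul_eq_mul, fS, QS]
  linear_combination (Complex.exp (40 * w) * ((w - 369 / 10000) ^ 2 + (10065 / 10000) ^ 2)) * I_sq

/-- The cofactor is differentiable with derivative `QS'`. -/
theorem hasDerivAt_QS (w : ℂ) : HasDerivAt QS (QS' w) w := by
  have hexp : HasDerivAt (fun y : ℂ => Complex.exp (40 * y)) (Complex.exp (40 * w) * 40) w := by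
    have h := ((hasDerivAt_id' w).const_mul (40 : ℂ)).cexp
    simpa using h
  have hlin : HasDerivAt (fun y : ℂ => y + I) 1 w := (hasDerivAt_id' w).add_const I
  have hP : HasDerivAt (fun y : ℂ => (y - 369 / 10000) ^ 2 + (10065 / 10000) ^ 2) (2 * (w - 369 / 10000)) w := by
    have h := (((hasDerivAt_id' w).sub_const (369 / 10000 : ℂ)).pow 2).add_const ((10065 / 10000 : ℂ) ^ 2)
    simpa using h
  exact hexp.mul (hlin.mul hP)

/-- The divided difference of `fS` at its simple zero `i` IS the cofactor: `dslope fS i = QS`. -/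
theorem dslope_fS_I : dslope fS I = QS := by
  classical
  rw [fS_eq_sub_smul_QS, dslope_sub_smul]
  have hd : deriv (fun x : ℂ => (x - I) • QS x) I = QS I := by
    have h : HasDerivAt (fun x : ℂ => (x - I) • QS x) ((I - I) • QS' I + (1 : ℂ) • QS I) I :=
      ((hasDerivAt_id' I).sub_const I).smul (hasDerivAt_QS I)
    rw [h.deriv]
    simp
  rw [hd, Function.update_eq_self]

/-- The canonical Newton field value at `(fS, 0, i)`: `K = QS′(i)/QS(i)`. -/
theorem newtonK_S : RhW08.AntiEscapeSplit7.newtonK fS 0 I = QS' I / QS I := by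
  unfold RhW08.AntiEscapeSplit7.newtonK
  rw [iteratedDeriv_zero, dslope_fS_I, (hasDerivAt_QS I).deriv]

/-- `Re D = a² + b² − 1 = 1440386/10⁸`. -/
theorem DW_re : DW.re = 1440386 / 100000000 := by
  simp [DW, sq]; norm_num

/-- `Im D = −2a = −738/10⁴`. -/
theorem DW_im : DW.im = -(738 / 10000) := by
  simp [DW, sq]; norm_num

/-- `D ≠ 0`. -/
theorem DW_ne : DW ≠ 0 := fun h => by
  have := congrArg Complex.re h
  rw [DW_re] at this
  norm_num at this

/-- `QS(i) = e^{40i}·(2i)·D ≠ 0`. -/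
theorem QS_I_ne : QS I ≠ 0 := by
  have h2 : (I + I) ≠ 0 := by
    intro h; have := congrArg Complex.im h; norm_num at this
  have hD : (I - 369 / 10000) ^ 2 + (10065 / 10000 : ℂ) ^ 2 ≠ 0 := DW_ne
  unfold QS
  exact mul_ne_zero (Complex.exp_ne_zero _) (mul_ne_zero h2 hD)

/-- ★ THE STATE FIELD IN CLOSED FORM: `tiltAt fS 0 i = (40·D + 2(i − a))/D` (= `40 + 1/(i − z) + 1/(i − z̄)`; the `e^{40i}` and the partner's
`1/(2i) + i/2 = 0` cancel). -/
theorem tiltAt_S : RhW08.BurgersRate.tiltAt fS 0 I = (40 * DW + 2 * (I - 369 / 10000)) / DW := by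
  rw [RhW08.BurgersRate.tiltAt, newtonK_S, I_im, ofReal_one, mul_one]
  rw [div_add_div _ _ QS_I_ne two_ne_zero, div_eq_div_iff (mul_ne_zero QS_I_ne two_ne_zero) DW_ne]
  unfold QS QS' DW
  linear_combination (2 * Complex.exp (40 * I) * ((I - 369 / 10000) ^ 2 + (10065 / 10000 : ℂ) ^ 2) ^ 2) * I_sq

/-- ★ THE FLOOR at W1*: `14 ≤ Im v·‖tiltAt fS 0 v‖` at `v = i` (`‖tilt‖² = 204.93`, crit-1's `κ_v = 14.3154`): no floor `κ₀ ≤ 14` excludes this level. -/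
theorem floor_S : (14 : ℝ) ≤ I.im * ‖RhW08.BurgersRate.tiltAt fS 0 I‖ := by
  rw [tiltAt_S, I_im, one_mul, norm_div]
  have hNre : (40 * DW + 2 * (I - 369 / 10000)).re = 50235440 / 100000000 := by
    simp [DW_re]; norm_num
  have hNim : (40 * DW + 2 * (I - 369 / 10000)).im = -(952 / 1000) := by
    simp [DW_im]; norm_num
  have hN : ‖40 * DW + 2 * (I - 369 / 10000)‖ ^ 2 = (50235440 / 100000000) ^ 2 + (952 / 1000) ^ 2 := by
    rw [Complex.sq_norm, Complex.normSq_apply, hNre, hNim]; ring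
  have hD : ‖DW‖ ^ 2 = (1440386 / 100000000) ^ 2 + (738 / 10000) ^ 2 := by
    rw [Complex.sq_norm, Complex.normSq_apply, DW_re, DW_im]; ring
  have hDpos : 0 < ‖DW‖ := norm_pos_iff.2 DW_ne
  rw [le_div_iff₀ hDpos]
  nlinarith [norm_nonneg (40 * DW + 2 * (I - 369 / 10000)), norm_nonneg DW]

/-- The floor at the constants of record `κ₀ = 3` (and a fortiori `2`). -/
theorem floor_S_three : (3 : ℝ) ≤ I.im * ‖RhW08.BurgersRate.tiltAt fS 0 I‖ :=
  le_trans (by norm_num) floor_S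

/-- ★★ THE INSTANCE at a CONSUMPTION level: (T)'s three pair binders `Touches ∧ AtomicPair ∧ (3 ≤ Im v·κ_v)` at `(fS, 0, i, z)` in unfolded shape —
the binders v1 quantified over are met by crit-1's killing frame; v2's extra binder `ApproachLevelQ` is what it fails (the mate is in the tent). -/
theorem binders_S :
    (iteratedDeriv 0 fS zS = 0 ∧ I.im < zS.im ∧ |I.re - zS.re| ≤ I.im + zS.im) ∧
    (∀ u : ℂ, iteratedDeriv 0 fS u = 0 → 0 < u.im → u ≠ I → u ≠ zS →
      I.im + u.im < |I.re - u.re| ∧ zS.im + u.im < |zS.re - u.re|) ∧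
    (3 : ℝ) ≤ I.im * ‖RhW08.BurgersRate.tiltAt fS 0 I‖ :=
  ⟨touches_S, atomicPair_S, floor_S_three⟩

end RhW08.TwoPairDatumW
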